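import Literature.AnabelianGeometry.EtaleTheta.ThetaSettingOriginClauses
import Literature.AnabelianGeometry.EtaleTheta.Discharge.Sec1Prop18Cusps
import Literature.AnabelianGeometry.EtaleTheta.Discharge.Sec1Thm110ModelTateInversionNV
import Literature.AnabelianGeometry.EtaleTheta.SettingModelKrullThm16i
import HarnessLib

/-!
# [EtTh] §1: the cone sites binding Thm. 1.6 (i) (`ThetaSetting.Thm16i`, FACT row F-0585) RE-CLOSED —
# nodes `EtTh:Prop1.8`, `EtTh:Thm1.6(i)`, `EtTh:Thm1.6(iii)` (K4 / C-R33 re-close; proof-only)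

S. Mochizuki, *The étale theta function and its Frobenioid-theoretic manifestations*, Publ. RIMS **45**
(2009) [EtTh], §1: Thm. 1.6 (i) p. 24 (printed 250) «We have: `γ(Π^tp_{Ÿα}) = Π^tp_{Ÿβ}`», Thm. 1.6 (iii)
pp. 24–25, Prop. 1.8 pp. 28–29 (printed 254–255) [cite: MochizukiEtTh2009, Thm 1.6 (i) p.24]. Cell abc-iut,
layer L2, seat abc-iut-L2-t12 (gen 9), L2-lead row R788 (M4). PROOF-ONLY (no definition, no instance, no
notation, no `Prop`-valued fact); every input is consumed BY NAME, nothing is restated.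

**What is re-closed.** abc-iut-c312-2's `CONE-K4-RECLOSE.tsv` v4 lists six cone CLOSING THEOREMS that bind
the refuted-closure FACT row F-0585 `ThetaSetting.Thm16i γ` as a hypothesis (`CONE-FACT-SURGERY.tsv`
l. 2430–2435): abc-iut-L2-t1's `ThetaSetting.symm_mem_GtpYdd` (#5), `ThetaSetting.transportFun_mem` (#6)
(`TemperedRigidity.lean`, nodes `EtTh:Thm1.6(i)` / `EtTh:Thm1.6(iii)`), and `preservesCoverings_iff_map_dotC`
(#11), `preservesCoverings_of_extension` (#13), `prop18pm_of_extension` (#13), `prop18_of_extension` (#13)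
(`Discharge/Sec1Prop18.lean`, nodes `EtTh:Thm1.6(i)` / `EtTh:Prop1.8`). Here each of them is re-derived with
that binder SUPPLIED by a CLOSED producer of the row (0 assumption-class FACT binders,
`CONE-FACT-PRODUCERS.tsv` l. 302–317):

* **§A — at the origin predicates (generic).** `h16 := ThetaSetting.IsThm16Origin.thm16i` (abc-iut-L2-t6 /
  abc-iut-w5-d051, `ThetaSettingOriginClauses`): for settings `α`, `β` satisfying the printed origin clauses
  `IsThm16Origin` (R1, R2, R3, TM₂, a cusp of `X^log` in `Π^tp_Y`, pp. 12–13) and an isomorphism `γ_X`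
  preserving `Δ^tp_X` (`hΔ`, [AbsAnab] Lem. 1.3.8) and cuspidal decomposition groups (`h65`, [SemiAnbd]
  Thm. 6.5 (iii)), the six closers hold WITHOUT the F-0585 binder (`…_of_origins`). In the `Ẋ`-case with the
  cusp characterisation intrinsic (abc-iut-L2-t1's `prop18_of_cusps`) the SAME `h65` feeds both inputs, so
  `prop18_of_cusps_of_origins` carries Prop. 1.8 modulo (a) the `K`-core extension, (b) the induced `γ_X`,
  (c′) the intrinsic cusp characterisation, `hΔ`, `h65` and the origin clauses — input (d) is DERIVED.
* **§B — at the models of record (inhabited).** (1) The stage-2 «Tate shear» record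
  `MuTwoSetting.modelχq p 1 2` with the NON-identity data of abc-iut-w5-d171's row «K2-NV @ STAGE 2»
  (`Γ := conjEpsPMχq` = conjugation by `ε_±` on `Π^tp_C = Π^tp_X ⋊_ι ℤ/2`, `γ_X := inversionχq p 1 2 = ι`,
  `γ := gammaDotCχq` = the inner automorphism of `Π^tp_Ċ` by `ε_± ε_μ`, `h16 := thm16i_inversionχq`,
  companion `companionInvχq`): all six closers fire there (`…_conjEpsPMχq`, `prop18pm_gammaDotCχq`,
  `exists_prop18_restrict_conjEpsPMχq`, `symm_mem_GtpYdd_inversionχq`, `transportFun_mem_inversionχq`);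
  (2) the cusped untwisted Krull model `modelκ′` (abc-iut-w5-d165: `modelκ'_isThm16Origin`,
  `modelκ'_thm16i` for EVERY `Δ^tp_X`-preserving `γ`): the two `TemperedRigidity` closers fire for every such
  `γ`, the theta companion being READ OFF the origin clause R3 (`IsThm16Origin.thetaCompanion`).
* **§C — census form** (`exists_thm16i_sites_reclosed_model`): ONE `MuTwoSetting` with admissible `ε_Z`,
  a covering-preserving `Γ`, `γ_X ≠ id` with Thm. 1.6 (i), and a `γ ≠ id` on `Π^tp_Ċ` with `Prop18pm`, plus a
  `γ′` on `Π^tp_Ẋ` with `Prop18` — all closers' conclusions jointly inhabited at non-identity data.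

The identity instance (`h16 := ThetaSetting.thm16i_refl`, every `D`) is PRE-EXISTING and not repeated:
abc-iut-f-113's `MuTwoSetting.prop18pm_refl`, abc-iut-f-114's `prop18_refl` / `preservesCoverings_refl`.

HONEST FRAMING: §A is a re-keying of kernel theorems onto the printed origin clauses (typed ≠ proved for
[EtTh]; the clauses are predicates, inhabited in the tree at `modelκ′` only); §B/§C are statements about OUR
semi-synthetic models (consistency / non-vacuity evidence for the typed interface, not the tempered
fundamental group of a curve). Nothing here asserts [EtTh] Thm. 1.6 or Prop. 1.8 for genuine curves; no side
is taken on [IUTchIII] Cor. 3.12; re-closed ≠ endorsed.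
-/

noncomputable section

namespace Literature.AnabelianGeometry.EtaleTheta

open Literature.AnabelianGeometry.SemiGraphs

variable {p : ℕ} [Fact p.Prime]

/-! ## §A. The six sites at the origin predicates (`h16 := IsThm16Origin.thm16i`) -/

namespace ThetaSetting.IsThm16Origin

variable {Dα Dβ : ThetaSetting p}

/-- Site `ThetaSetting.symm_mem_GtpYdd` (#5 `h`) re-closed at the origin predicates: for origin settings
`α`, `β` and `γ : Π^tp_{Xα} ⥲ Π^tp_{Xβ}` preserving `Δ^tp_X` and cuspidal decomposition groups,
`γ⁻¹(Π^tp_{Ÿβ}) ⊆ Π^tp_{Ÿα}` — Thm. 1.6 (i) supplied by `IsThm16Origin.thm16i`, not assumed.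
[cite: MochizukiEtTh2009, Thm 1.6 (i) p.24] -/
theorem symm_mem_GtpYdd_of_origins (hα : Dα.IsThm16Origin) (hβ : Dβ.IsThm16Origin)
    (γ : Dα.PiTemp ≃ₜ* Dβ.PiTemp)
    (hΔ : Dα.DeltaTemp.map γ.toMulEquiv.toMonoidHom = Dβ.DeltaTemp)
    (h65 : Dα.IsoPreservesCuspidalDecomp Dβ.toTemperedCurve) (x : Dβ.GtpYdd) :
    γ.toMulEquiv.symm x.1 ∈ Dα.GtpYdd :=
  ThetaSetting.symm_mem_GtpYdd (hα.thm16i hβ γ hΔ h65) x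

/-- Site `ThetaSetting.transportFun_mem` (#6 `h`) re-closed at the origin predicates: the transport of a
continuous cocycle `Π^tp_{Ÿα} → (Δ_Θ)α` along `(γ, c)` is a continuous cocycle on `Π^tp_{Ÿβ}`, for ANY theta
companion `c` of `γ` — Thm. 1.6 (i) supplied by `IsThm16Origin.thm16i`. [cite: MochizukiEtTh2009, Thm 1.6 (iii) p.24] -/
theorem transportFun_mem_of_origins (hα : Dα.IsThm16Origin) (hβ : Dβ.IsThm16Origin)
    (γ : Dα.PiTemp ≃ₜ* Dβ.PiTemp)
    (hΔ : Dα.DeltaTemp.map γ.toMulEquiv.toMonoidHom = Dβ.DeltaTemp)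
    (h65 : Dα.IsoPreservesCuspidalDecomp Dβ.toTemperedCurve) (c : ThetaSetting.ThetaCompanion γ)
    {f : Dα.GtpYdd → Dα.DeltaTheta} (hf : f ∈ contCocycles Dα.toTheta Dα.DeltaTheta Dα.GtpYdd) :
    ThetaSetting.transportFun c (hα.thm16i hβ γ hΔ h65) f ∈
      contCocycles Dβ.toTheta Dβ.DeltaTheta Dβ.GtpYdd :=
  ThetaSetting.transportFun_mem c _ hf

/-- The same site with the theta companion ALSO read off the origin clauses (R3, `IsThm16Origin.thetaCompanion`:
«`γ` induces an isomorphism `(Δ_Θ)α ⥲ (Δ_Θ)β`», Thm. 1.6 (ii)): both auxiliary binders of the cohomology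
transport of Thm. 1.6 (iii) are theorems at the origin predicates. [cite: MochizukiEtTh2009, Thm 1.6 (iii) p.24] -/
theorem transportFun_mem_thetaCompanion_of_origins (hα : Dα.IsThm16Origin) (hβ : Dβ.IsThm16Origin)
    (γ : Dα.PiTemp ≃ₜ* Dβ.PiTemp)
    (hΔ : Dα.DeltaTemp.map γ.toMulEquiv.toMonoidHom = Dβ.DeltaTemp)
    (h65 : Dα.IsoPreservesCuspidalDecomp Dβ.toTemperedCurve)
    {f : Dα.GtpYdd → Dα.DeltaTheta} (hf : f ∈ contCocycles Dα.toTheta Dα.DeltaTheta Dα.GtpYdd) :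
    ThetaSetting.transportFun (hα.thetaCompanion hβ γ hΔ) (hα.thm16i hβ γ hΔ h65) f ∈
      contCocycles Dβ.toTheta Dβ.DeltaTheta Dβ.GtpYdd :=
  ThetaSetting.transportFun_mem _ _ hf

end ThetaSetting.IsThm16Origin

section Prop18OfOrigins

variable {Mα Mβ : MuTwoSetting p} {εα : Mα.GtpC} {εβ : Mβ.GtpC}

/-- Site `preservesCoverings_iff_map_dotC` (#11 `h16`) re-closed at the origin predicates: for admissible
`ε_{Z,α}`, `ε_{Z,β}`, `Γ : Π^tp_{Cα} ⥲ Π^tp_{Cβ}` compatible with a `Δ^tp_X`- and cusp-preserving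
`γ_X : Π^tp_{Xα} ⥲ Π^tp_{Xβ}` over origin settings, preserving the diagram of coverings of Def. 1.7 is
EQUIVALENT to `Γ(Π^tp_{Ċα}) = Π^tp_{Ċβ}` — Thm. 1.6 (i) for `γ_X` supplied by `IsThm16Origin.thm16i`.
[cite: MochizukiEtTh2009, Prop 1.8 p.28] -/
theorem preservesCoverings_iff_map_dotC_of_origins (hOα : Mα.toThetaSetting.IsThm16Origin)
    (hOβ : Mβ.toThetaSetting.IsThm16Origin) (hα : Mα.IsAdmissibleEpsZ εα) (hβ : Mβ.IsAdmissibleEpsZ εβ)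
    (Γ : Mα.GtpC ≃ₜ* Mβ.GtpC) (γX : Mα.PiTemp ≃ₜ* Mβ.PiTemp)
    (hγX : ∀ x, Mβ.inclX (γX.toMulEquiv x) = Γ.toMulEquiv (Mα.inclX x))
    (hΔ : Mα.DeltaTemp.map γX.toMulEquiv.toMonoidHom = Mβ.DeltaTemp)
    (h65 : TemperedCurve.IsoPreservesCuspidalDecomp Mα.toTemperedCurve Mβ.toTemperedCurve) :
    PreservesCoverings εα εβ Γ ↔ (Mα.dotC εα).map Γ.toMulEquiv.toMonoidHom = Mβ.dotC εβ :=
  preservesCoverings_iff_map_dotC hα hβ Γ γX hγX (hOα.thm16i hOβ γX hΔ h65)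

/-- Site `preservesCoverings_of_extension` (#13 `h16`) re-closed at the origin predicates: an extension `Γ`
of `γ : Π^tp_{Ċα} ⥲ Π^tp_{Ċβ}` up to an inner automorphism, compatible with `Π^tp_X` through a `Δ^tp_X`- and
cusp-preserving `γ_X` over origin settings, preserves the whole diagram of coverings (pp. 28–29).
[cite: MochizukiEtTh2009, Prop 1.8 p.28] -/
theorem preservesCoverings_of_extension_of_origins (hOα : Mα.toThetaSetting.IsThm16Origin)
    (hOβ : Mβ.toThetaSetting.IsThm16Origin) (hα : Mα.IsAdmissibleEpsZ εα) (hβ : Mβ.IsAdmissibleEpsZ εβ)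
    (γ : Mα.dotC εα ≃ₜ* Mβ.dotC εβ) (Γ : Mα.GtpC ≃ₜ* Mβ.GtpC)
    (hres : ∃ c : Mβ.GtpC, ∀ x : Mα.dotC εα, Γ.toMulEquiv x.1 = c * (γ.toMulEquiv x).1 * c⁻¹)
    (γX : Mα.PiTemp ≃ₜ* Mβ.PiTemp)
    (hγX : ∀ x, Mβ.inclX (γX.toMulEquiv x) = Γ.toMulEquiv (Mα.inclX x))
    (hΔ : Mα.DeltaTemp.map γX.toMulEquiv.toMonoidHom = Mβ.DeltaTemp)
    (h65 : TemperedCurve.IsoPreservesCuspidalDecomp Mα.toTemperedCurve Mβ.toTemperedCurve) :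
    PreservesCoverings εα εβ Γ :=
  preservesCoverings_of_extension hα hβ γ Γ hres γX hγX (hOα.thm16i hOβ γX hΔ h65)

/-- Site `prop18pm_of_extension` (#13 `h16`) re-closed at the origin predicates: **Prop. 1.8, the `Ċ`-case,
over origin settings**, modulo (a) the `K`-core extension `Γ` of `γ` ([SemiAnbd] Thm. 6.8 (ii) + (II)),
(b) the induced `γ_X` ([AbsCusp] Lem. 2.1 (v)), `γ_X` preserving `Δ^tp_X` ([AbsAnab] Lem. 1.3.8) and cuspidal
decomposition groups ([SemiAnbd] Thm. 6.5 (iii)) — input (d) Thm. 1.6 (i) is DERIVED (`IsThm16Origin.thm16i`).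
[cite: MochizukiEtTh2009, Prop 1.8 p.28] -/
theorem prop18pm_of_extension_of_origins (hOα : Mα.toThetaSetting.IsThm16Origin)
    (hOβ : Mβ.toThetaSetting.IsThm16Origin) (hα : Mα.IsAdmissibleEpsZ εα) (hβ : Mβ.IsAdmissibleEpsZ εβ)
    (γ : Mα.dotC εα ≃ₜ* Mβ.dotC εβ) (Γ : Mα.GtpC ≃ₜ* Mβ.GtpC)
    (hres : ∃ c : Mβ.GtpC, ∀ x : Mα.dotC εα, Γ.toMulEquiv x.1 = c * (γ.toMulEquiv x).1 * c⁻¹)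
    (γX : Mα.PiTemp ≃ₜ* Mβ.PiTemp)
    (hγX : ∀ x, Mβ.inclX (γX.toMulEquiv x) = Γ.toMulEquiv (Mα.inclX x))
    (hΔ : Mα.DeltaTemp.map γX.toMulEquiv.toMonoidHom = Mβ.DeltaTemp)
    (h65 : TemperedCurve.IsoPreservesCuspidalDecomp Mα.toTemperedCurve Mβ.toTemperedCurve) :
    Prop18pm hα hβ γ :=
  prop18pm_of_extension hα hβ γ Γ hres γX hγX (hOα.thm16i hOβ γX hΔ h65)

/-- Site `prop18_of_extension` (#13 `h16`) re-closed at the origin predicates: **Prop. 1.8, the `Ẋ`-case,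
over origin settings**, modulo (a), (b), (c) `Γ(Π^tp_{Ċα}) = Π^tp_{Ċβ}`, `hΔ`, `h65` — input (d) DERIVED.
[cite: MochizukiEtTh2009, Prop 1.8 p.28] -/
theorem prop18_of_extension_of_origins (hOα : Mα.toThetaSetting.IsThm16Origin)
    (hOβ : Mβ.toThetaSetting.IsThm16Origin) (hα : Mα.IsAdmissibleEpsZ εα) (hβ : Mβ.IsAdmissibleEpsZ εβ)
    (γ : Mα.dotX εα ≃ₜ* Mβ.dotX εβ) (Γ : Mα.GtpC ≃ₜ* Mβ.GtpC)
    (hres : ∃ c : Mβ.GtpC, ∀ x : Mα.dotX εα, Γ.toMulEquiv x.1 = c * (γ.toMulEquiv x).1 * c⁻¹)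
    (γX : Mα.PiTemp ≃ₜ* Mβ.PiTemp)
    (hγX : ∀ x, Mβ.inclX (γX.toMulEquiv x) = Γ.toMulEquiv (Mα.inclX x))
    (hΔ : Mα.DeltaTemp.map γX.toMulEquiv.toMonoidHom = Mβ.DeltaTemp)
    (h65 : TemperedCurve.IsoPreservesCuspidalDecomp Mα.toTemperedCurve Mβ.toTemperedCurve)
    (hC : (Mα.dotC εα).map Γ.toMulEquiv.toMonoidHom = Mβ.dotC εβ) : Prop18 hα hβ γ :=
  prop18_of_extension hα hβ γ Γ hres γX hγX (hOα.thm16i hOβ γX hΔ h65) hC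

/-- **Prop. 1.8, the `Ẋ`-case with the cusp characterisation intrinsic, over origin settings**
(abc-iut-L2-t1's `prop18_of_cusps` with its binder `h16` DERIVED): ONE hypothesis `h65` ([SemiAnbd]
Thm. 6.5 (iii) for `(Xα, Xβ)`) now serves both the transport of the cusp action (c′) and Thm. 1.6 (i) (d);
what remains is (a) the `K`-core extension `Γ`, (b) the induced `γ_X` with `hΔ`, (c′) print's intrinsic
characterisation of `Ċ` on each side, and the origin clauses. [cite: MochizukiEtTh2009, Prop 1.8 p.28] -/
theorem prop18_of_cusps_of_origins (hOα : Mα.toThetaSetting.IsThm16Origin)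
    (hOβ : Mβ.toThetaSetting.IsThm16Origin) (hα : Mα.IsAdmissibleEpsZ εα) (hβ : Mβ.IsAdmissibleEpsZ εβ)
    (γ : Mα.dotX εα ≃ₜ* Mβ.dotX εβ) (Γ : Mα.GtpC ≃ₜ* Mβ.GtpC)
    (hres : ∃ c : Mβ.GtpC, ∀ x : Mα.dotX εα, Γ.toMulEquiv x.1 = c * (γ.toMulEquiv x).1 * c⁻¹)
    (γX : Mα.PiTemp ≃ₜ* Mβ.PiTemp)
    (hγX : ∀ x, Mβ.inclX (γX.toMulEquiv x) = Γ.toMulEquiv (Mα.inclX x))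
    (hΔ : Mα.DeltaTemp.map γX.toMulEquiv.toMonoidHom = Mβ.DeltaTemp)
    (h65 : TemperedCurve.IsoPreservesCuspidalDecomp Mα.toTemperedCurve Mβ.toTemperedCurve)
    (hcα : ∀ g : Mα.GtpC, g ∉ Mα.inclX.range → (g ∈ Mα.dotC εα ↔
      ¬ ∀ D : Subgroup Mα.PiTemp, Mα.IsCuspidalDecompositionGroup D →
        ∃ h ∈ Mα.dotX εα,
          ((D ⊓ (Mα.dotX εα).comap Mα.inclX).map Mα.inclX).map (MulAut.conj g).toMonoidHom =
            ((D ⊓ (Mα.dotX εα).comap Mα.inclX).map Mα.inclX).map (MulAut.conj h).toMonoidHom))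
    (hcβ : ∀ g : Mβ.GtpC, g ∉ Mβ.inclX.range → (g ∈ Mβ.dotC εβ ↔
      ¬ ∀ D : Subgroup Mβ.PiTemp, Mβ.IsCuspidalDecompositionGroup D →
        ∃ h ∈ Mβ.dotX εβ,
          ((D ⊓ (Mβ.dotX εβ).comap Mβ.inclX).map Mβ.inclX).map (MulAut.conj g).toMonoidHom =
            ((D ⊓ (Mβ.dotX εβ).comap Mβ.inclX).map Mβ.inclX).map (MulAut.conj h).toMonoidHom)) :
    Prop18 hα hβ γ :=
  prop18_of_cusps hα hβ γ Γ hres γX hγX (hOα.thm16i hOβ γX hΔ h65) h65 hcα hcβ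

end Prop18OfOrigins

/-! ## §B. The six sites at the models of record -/

namespace SettingModel

variable (p)

/-! ### §B.1 The stage-2 record `modelχq p 1 2` with `Γ = conj ε_±`, `γ_X = ι`, `γ = conj (ε_± ε_μ)|_{Π^tp_Ċ}` -/

/-- Site `ThetaSetting.symm_mem_GtpYdd` at the stage-2 inversion `ι` of `modelχq p i j` (`h16 :=
thm16i_inversionχq`, abc-iut-L2-d1): `ι⁻¹(Π^tp_Ÿ) ⊆ Π^tp_Ÿ`. [cite: MochizukiEtTh2009, Thm 1.6 (i) p.24] -/
theorem symm_mem_GtpYdd_inversionχq (i j : ℤ) (hj : Even j) (x : (ThetaSetting.modelχq p i j hj).GtpYdd) :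
    (inversionχq p i j).toMulEquiv.symm x.1 ∈ (ThetaSetting.modelχq p i j hj).GtpYdd :=
  ThetaSetting.symm_mem_GtpYdd (thm16i_inversionχq p i j hj) x

/-- Site `ThetaSetting.transportFun_mem` at the stage-2 inversion `ι` of `modelχq p i j` (`h16 :=
thm16i_inversionχq`), for any theta companion `c` of `ι` (at `(i, j) = (1, 2)`: abc-iut-w5-d171's
`companionInvχq`): transported cocycles are cocycles. [cite: MochizukiEtTh2009, Thm 1.6 (iii) p.24] -/
theorem transportFun_mem_inversionχq (i j : ℤ) (hj : Even j)
    (c : ThetaSetting.ThetaCompanion (Dα := ThetaSetting.modelχq p i j hj)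
      (Dβ := ThetaSetting.modelχq p i j hj) (inversionχq p i j))
    {f : (ThetaSetting.modelχq p i j hj).GtpYdd → (ThetaSetting.modelχq p i j hj).DeltaTheta}
    (hf : f ∈ contCocycles (ThetaSetting.modelχq p i j hj).toTheta (ThetaSetting.modelχq p i j hj).DeltaTheta
      (ThetaSetting.modelχq p i j hj).GtpYdd) :
    ThetaSetting.transportFun c (thm16i_inversionχq p i j hj) f ∈
      contCocycles (ThetaSetting.modelχq p i j hj).toTheta (ThetaSetting.modelχq p i j hj).DeltaTheta
        (ThetaSetting.modelχq p i j hj).GtpYdd :=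
  ThetaSetting.transportFun_mem c _ hf

/-- The `(1, 2)` instance with the companion of record `companionInvχq` (abc-iut-w5-d171).
[cite: MochizukiEtTh2009, Thm 1.6 (iii) p.24] -/
theorem transportFun_mem_companionInvχq
    {f : (ThetaSetting.modelχq p 1 2 even_two).GtpYdd → (ThetaSetting.modelχq p 1 2 even_two).DeltaTheta}
    (hf : f ∈ contCocycles (ThetaSetting.modelχq p 1 2 even_two).toTheta
      (ThetaSetting.modelχq p 1 2 even_two).DeltaTheta (ThetaSetting.modelχq p 1 2 even_two).GtpYdd) :
    ThetaSetting.transportFun (companionInvχq p) (thm16i_inversionχq p 1 2 even_two) f ∈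
      contCocycles (ThetaSetting.modelχq p 1 2 even_two).toTheta (ThetaSetting.modelχq p 1 2 even_two).DeltaTheta
        (ThetaSetting.modelχq p 1 2 even_two).GtpYdd :=
  transportFun_mem_inversionχq p 1 2 even_two (companionInvχq p) hf

/-- `inclX ∘ ι = Γ ∘ inclX` for `Γ = conj ε_±` (abc-iut-w5-d171's `conjEpsPMχq_inl`, read as the compatibility
binder `hγX` of the Prop. 1.8 closers). [cite: MochizukiEtTh2009, Prop 1.8 p.28] -/
theorem inclX_inversionχq_eq_conjEpsPMχq (x : (MuTwoSetting.modelχq p 1 2 even_two).PiTemp) :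
    (MuTwoSetting.modelχq p 1 2 even_two).inclX ((inversionχq p 1 2).toMulEquiv x) =
      (conjEpsPMχq p).toMulEquiv ((MuTwoSetting.modelχq p 1 2 even_two).inclX x) :=
  (conjEpsPMχq_inl p x).symm

/-- `Γ = conj ε_±` restricts to `γ = conj (ε_± ε_μ)` on `Π^tp_Ċ` up to the inner automorphism by
`ε_± ε_μ⁻¹ ε_±⁻¹` (the `restricts` field of abc-iut-w5-d171's `thm110HypothesisInvχq`, read as the binder
`hres`). [cite: MochizukiEtTh2009, Prop 1.8 p.28] -/
theorem exists_conjEpsPMχq_restricts_gammaDotCχq :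
    ∃ c : (MuTwoSetting.modelχq p 1 2 even_two).GtpC,
      ∀ x : (MuTwoSetting.modelχq p 1 2 even_two).dotC (epsZχq p),
        (conjEpsPMχq p).toMulEquiv x.1 = c * ((gammaDotCχq p).toMulEquiv x).1 * c⁻¹ :=
  (thm110HypothesisInvχq p).restricts

/-- Site `preservesCoverings_iff_map_dotC` at the stage-2 record (`Γ := conj ε_±`, `γ_X := ι`, `h16 :=
thm16i_inversionχq`): `Γ` preserves the coverings of Def. 1.7 iff `Γ(Π^tp_Ċ) = Π^tp_Ċ`.
[cite: MochizukiEtTh2009, Prop 1.8 p.28] -/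
theorem preservesCoverings_iff_map_dotC_conjEpsPMχq :
    PreservesCoverings (Mα := MuTwoSetting.modelχq p 1 2 even_two) (Mβ := MuTwoSetting.modelχq p 1 2 even_two)
        (epsZχq p) (epsZχq p) (conjEpsPMχq p) ↔
      ((MuTwoSetting.modelχq p 1 2 even_two).dotC (epsZχq p)).map (conjEpsPMχq p).toMulEquiv.toMonoidHom =
        (MuTwoSetting.modelχq p 1 2 even_two).dotC (epsZχq p) :=
  preservesCoverings_iff_map_dotC (modelχq_isAdmissibleEpsZ p) (modelχq_isAdmissibleEpsZ p) (conjEpsPMχq p)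
    (inversionχq p 1 2) (inclX_inversionχq_eq_conjEpsPMχq p) (thm16i_inversionχq p 1 2 even_two)

/-- Site `preservesCoverings_of_extension` at the stage-2 record: `Γ := conj ε_±`, extending `γ := conj (ε_± ε_μ)`
on `Π^tp_Ċ` up to an inner automorphism and restricting to `ι` on `Π^tp_X` with Thm. 1.6 (i), PRESERVES THE
COVERINGS — re-derived THROUGH the closer (abc-iut-w5-d171's `preservesCoverings_conjEpsPMχq` is the direct
proof of the same statement). [cite: MochizukiEtTh2009, Prop 1.8 p.28] -/
theorem preservesCoverings_conjEpsPMχq_of_extension :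
    PreservesCoverings (Mα := MuTwoSetting.modelχq p 1 2 even_two) (Mβ := MuTwoSetting.modelχq p 1 2 even_two)
      (epsZχq p) (epsZχq p) (conjEpsPMχq p) :=
  preservesCoverings_of_extension (modelχq_isAdmissibleEpsZ p) (modelχq_isAdmissibleEpsZ p) (gammaDotCχq p)
    (conjEpsPMχq p) (exists_conjEpsPMχq_restricts_gammaDotCχq p) (inversionχq p 1 2)
    (inclX_inversionχq_eq_conjEpsPMχq p) (thm16i_inversionχq p 1 2 even_two)

/-- Site `prop18pm_of_extension` at the stage-2 record: **the typed conclusion of Prop. 1.8 (`Ċ`-case) HOLDS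
for the NON-identity `γ := conj (ε_± ε_μ)|_{Π^tp_Ċ}`** (`gammaDotCχq`, `≠ id` by abc-iut-w5-d171's
`gammaDotCχq_ne_refl`), through the closer with `h16 := thm16i_inversionχq`. [cite: MochizukiEtTh2009, Prop 1.8 p.28] -/
theorem prop18pm_gammaDotCχq :
    Prop18pm (modelχq_isAdmissibleEpsZ p) (modelχq_isAdmissibleEpsZ p) (gammaDotCχq p) :=
  prop18pm_of_extension (modelχq_isAdmissibleEpsZ p) (modelχq_isAdmissibleEpsZ p) (gammaDotCχq p)
    (conjEpsPMχq p) (exists_conjEpsPMχq_restricts_gammaDotCχq p) (inversionχq p 1 2)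
    (inclX_inversionχq_eq_conjEpsPMχq p) (thm16i_inversionχq p 1 2 even_two)

/-- Site `prop18_of_extension` at the stage-2 record: **the typed conclusion of Prop. 1.8 (`Ẋ`-case) HOLDS for
the restriction `γ′` of `Γ = conj ε_±` to `Π^tp_Ẋ`** (a topological automorphism of `Π^tp_Ẋ` with
`γ′ x = Γ x`; input (c) `Γ(Π^tp_Ċ) = Π^tp_Ċ` from abc-iut-w5-d171's `preservesCoverings_conjEpsPMχq`), through
the closer with `h16 := thm16i_inversionχq`. [cite: MochizukiEtTh2009, Prop 1.8 p.28] -/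
theorem exists_prop18_restrict_conjEpsPMχq :
    ∃ γ' : ↥((MuTwoSetting.modelχq p 1 2 even_two).dotX (epsZχq p)) ≃ₜ*
        ↥((MuTwoSetting.modelχq p 1 2 even_two).dotX (epsZχq p)),
      (∀ x, ((γ' x : ↥((MuTwoSetting.modelχq p 1 2 even_two).dotX (epsZχq p))) : PiTpCq p 1 2) =
        conjEpsPMχq p x.1) ∧
      Prop18 (modelχq_isAdmissibleEpsZ p) (modelχq_isAdmissibleEpsZ p) γ' := by
  have hmap := (preservesCoverings_conjEpsPMχq p).map_dotX
  have hmem : ∀ x : ↥((MuTwoSetting.modelχq p 1 2 even_two).dotX (epsZχq p)),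
      conjEpsPMχq p x.1 ∈ (MuTwoSetting.modelχq p 1 2 even_two).dotX (epsZχq p) := fun x => by
    have hx : conjEpsPMχq p x.1 ∈
        ((MuTwoSetting.modelχq p 1 2 even_two).dotX (epsZχq p)).map (conjEpsPMχq p).toMulEquiv.toMonoidHom :=
      ⟨x.1, x.2, rfl⟩
    rwa [hmap] at hx
  have hmem' : ∀ x : ↥((MuTwoSetting.modelχq p 1 2 even_two).dotX (epsZχq p)),
      (conjEpsPMχq p).symm x.1 ∈ (MuTwoSetting.modelχq p 1 2 even_two).dotX (epsZχq p) := fun x => by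
    have hx : (conjEpsPMχq p).symm x.1 = conjEpsPMχq p x.1 := by
      rw [← conjEpsPMχq_conjEpsPMχq p ((conjEpsPMχq p).symm x.1), ContinuousMulEquiv.apply_symm_apply]
    rw [hx]
    exact hmem x
  let γ' : ↥((MuTwoSetting.modelχq p 1 2 even_two).dotX (epsZχq p)) ≃ₜ*
      ↥((MuTwoSetting.modelχq p 1 2 even_two).dotX (epsZχq p)) :=
    { toFun := fun x => ⟨conjEpsPMχq p x.1, hmem x⟩
      invFun := fun x => ⟨(conjEpsPMχq p).symm x.1, hmem' x⟩
      left_inv := fun x => Subtype.ext ((conjEpsPMχq p).symm_apply_apply x.1)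
      right_inv := fun x => Subtype.ext ((conjEpsPMχq p).apply_symm_apply x.1)
      map_mul' := fun x y => Subtype.ext (map_mul (conjEpsPMχq p) x.1 y.1)
      continuous_toFun := ((conjEpsPMχq p).continuous.comp continuous_subtype_val).subtype_mk _
      continuous_invFun := ((conjEpsPMχq p).symm.continuous.comp continuous_subtype_val).subtype_mk _ }
  refine ⟨γ', fun x => rfl, ?_⟩
  exact prop18_of_extension (modelχq_isAdmissibleEpsZ p) (modelχq_isAdmissibleEpsZ p) γ' (conjEpsPMχq p)
    ⟨1, fun x => by rw [one_mul, inv_one, mul_one]; rfl⟩ (inversionχq p 1 2)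
    (inclX_inversionχq_eq_conjEpsPMχq p) (thm16i_inversionχq p 1 2 even_two)
    (preservesCoverings_conjEpsPMχq p).map_dotC

/-! ### §B.2 The cusped untwisted Krull model `modelκ′` (an `IsThm16Origin` model): every `Δ^tp_X`-preserving `γ` -/

/-- Site `ThetaSetting.symm_mem_GtpYdd` at `modelκ′` for EVERY `Δ^tp_X`-preserving topological automorphism
`γ` of `Π^tp_X` (`h16 := modelκ'_thm16i`, abc-iut-w5-d165): `γ⁻¹(Π^tp_Ÿ) ⊆ Π^tp_Ÿ`.
[cite: MochizukiEtTh2009, Thm 1.6 (i) p.24] -/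
theorem symm_mem_GtpYdd_modelκ' (γ : (ThetaSetting.modelκ' p).PiTemp ≃ₜ* (ThetaSetting.modelκ' p).PiTemp)
    (hΔ : (ThetaSetting.modelκ' p).DeltaTemp.map γ.toMulEquiv.toMonoidHom = (ThetaSetting.modelκ' p).DeltaTemp)
    (x : (ThetaSetting.modelκ' p).GtpYdd) :
    γ.toMulEquiv.symm x.1 ∈ (ThetaSetting.modelκ' p).GtpYdd :=
  ThetaSetting.symm_mem_GtpYdd (modelκ'_thm16i p γ hΔ) x

/-- Site `ThetaSetting.transportFun_mem` at `modelκ′` for EVERY `Δ^tp_X`-preserving `γ`, BOTH auxiliary binders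
supplied: `h16 := modelκ'_thm16i` and the theta companion read off the origin clause R3 at `modelκ′`
(`modelκ'_isThm16Origin`, `IsThm16Origin.thetaCompanion`). (The coefficient instances `Δ_Θ ⊴ (Π^tp_X)^Θ`,
`Δ_Θ` commutative are abc-iut-L2-t1's generic `deltaTheta_normal` / `deltaTheta_comm`, named here because the
model is reducible.) [cite: MochizukiEtTh2009, Thm 1.6 (iii) p.24] -/
theorem transportFun_mem_modelκ' (γ : (ThetaSetting.modelκ' p).PiTemp ≃ₜ* (ThetaSetting.modelκ' p).PiTemp)
    (hΔ : (ThetaSetting.modelκ' p).DeltaTemp.map γ.toMulEquiv.toMonoidHom = (ThetaSetting.modelκ' p).DeltaTemp)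
    {f : (ThetaSetting.modelκ' p).GtpYdd → (ThetaSetting.modelκ' p).DeltaTheta}
    (hf : f ∈ @contCocycles _ _ _ _ _ _ _ (ThetaSetting.modelκ' p).toTheta (ThetaSetting.modelκ' p).DeltaTheta
      (ThetaSetting.deltaTheta_normal _) (ThetaSetting.deltaTheta_comm _) (ThetaSetting.modelκ' p).GtpYdd) :
    ThetaSetting.transportFun
        ((ThetaSetting.modelκ'_isThm16Origin p).thetaCompanion (ThetaSetting.modelκ'_isThm16Origin p) γ hΔ)
        (modelκ'_thm16i p γ hΔ) f ∈
      @contCocycles _ _ _ _ _ _ _ (ThetaSetting.modelκ' p).toTheta (ThetaSetting.modelκ' p).DeltaTheta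
        (ThetaSetting.deltaTheta_normal _) (ThetaSetting.deltaTheta_comm _) (ThetaSetting.modelκ' p).GtpYdd :=
  ThetaSetting.transportFun_mem _ _ hf

/-! ## §C. Census form: all six conclusions jointly inhabited at non-identity data -/

/-- **CENSUS FORM (numbers, not adjectives).** There is ONE `MuTwoSetting` (witness: the stage-2 record
`modelχq p 1 2`) with an admissible `ε_Z`, a topological automorphism `Γ` of `Π^tp_C`, a topological
automorphism `γ_X ≠ id` of `Π^tp_X` compatible with `Γ` and satisfying Thm. 1.6 (i), a theta companion of
`γ_X`, a topological automorphism `γ ≠ id` of `Π^tp_Ċ` to which `Γ` restricts up to an inner automorphism,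
such that `Γ` preserves the coverings, `Prop18pm` holds for `γ`, and `Prop18` holds for some `γ′` on `Π^tp_Ẋ`
— every closing theorem of the three nodes has its conclusion inhabited at non-identity data, with the F-0585
binder a THEOREM there. [cite: MochizukiEtTh2009, Prop 1.8 p.28] -/
theorem exists_thm16i_sites_reclosed_model :
    ∃ (M : MuTwoSetting p) (εZ : M.GtpC) (hZ : M.IsAdmissibleEpsZ εZ) (Γ : M.GtpC ≃ₜ* M.GtpC)
      (γX : M.PiTemp ≃ₜ* M.PiTemp) (_ : ThetaSetting.ThetaCompanion γX) (γ : M.dotC εZ ≃ₜ* M.dotC εZ),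
      γX.toMulEquiv ≠ MulEquiv.refl _ ∧ γ ≠ ContinuousMulEquiv.refl _ ∧ ThetaSetting.Thm16i γX ∧
      (∀ x, M.inclX (γX.toMulEquiv x) = Γ.toMulEquiv (M.inclX x)) ∧
      (∃ c : M.GtpC, ∀ x : M.dotC εZ, Γ.toMulEquiv x.1 = c * (γ.toMulEquiv x).1 * c⁻¹) ∧
      PreservesCoverings εZ εZ Γ ∧ Prop18pm hZ hZ γ ∧
      ∃ γ' : M.dotX εZ ≃ₜ* M.dotX εZ, Prop18 hZ hZ γ' :=
  ⟨MuTwoSetting.modelχq p 1 2 even_two, epsZχq p, modelχq_isAdmissibleEpsZ p, conjEpsPMχq p,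
    inversionχq p 1 2, companionInvχq p, gammaDotCχq p, inversionχq_ne_refl p 1 2, gammaDotCχq_ne_refl p,
    thm16i_inversionχq p 1 2 even_two, inclX_inversionχq_eq_conjEpsPMχq p,
    exists_conjEpsPMχq_restricts_gammaDotCχq p, preservesCoverings_conjEpsPMχq_of_extension p,
    prop18pm_gammaDotCχq p,
    let ⟨γ', _, h⟩ := exists_prop18_restrict_conjEpsPMχq p; ⟨γ', h⟩⟩

end SettingModel

end Literature.AnabelianGeometry.EtaleTheta

end
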